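import Literature.NumberTheory.EllipticCurves.RationalTwoTorsionSemistableModPIrreducibleProofs
import Literature.NumberTheory.EllipticCurves.KubertTwoTenProofs
import Literature.NumberTheory.EllipticCurves.X1ElevenMordellWeil
import Literature.NumberTheory.EllipticCurves.MazurTorsionSplit
import HarnessLib

/-!
# Ribet 1997, Prop. 1 (semistable case), prime by prime: the torsion input is only
# "no `E/ℚ` has rational `P₁ ≠ P₂` of order `2` and `Q` of order `p`"

`Proofs` file (theorems only: no definitions, no named facts), topic `NumberTheory/EllipticCurves`;
companion of `RationalTwoTorsionSemistableModPIrreducibleProofs`, whose theorem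
`hasIrreducibleModPGaloisRep_of_isSemistable_of_rational_two_torsion_of_mazur_torsion` takes
Mazur's full torsion theorem `∀ V, mazur_torsion V` (Mazur 1977, Thm. 8) as input.  In Ribet's
proof (Acta Arith. 79 (1997), Prop. 1, p. 11: "some elliptic curve over `ℚ` which is isogenous to
`E` contains a group of rational points which is isomorphic to `ℤ/2ℤ ⊕ ℤ/2lℤ`.  The existence of
such a curve is incompatible with "Ogg's Conjecture", which was proved by Mazur") the classification
enters only through the following statement, for the ONE prime `l = p` at hand:

  `(⋆ₚ)`  no elliptic curve over `ℚ` has rational points `P₁ ≠ P₂` of order `2` and `Q` of order `p`.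

This file re-threads the theorem through `(⋆ₚ)` (stated in place as a hypothesis, not as a
definition) and records which published leaf gives `(⋆ₚ)` for each prime `p ≥ 5`:

* `p = 5`: Kubert 1976, `X₁(2,10)(ℚ)` is cuspidal — the tree's THEOREM `Kubert1976_no_two_ten_holds`
  (`P₁` and `P₂ + Q` generate `ℤ/2 × ℤ/10`);
* `p = 7`: no rational point of order `14` (`X₁(14)(ℚ)` is cuspidal; Kubert 1976, Ch. IV — in the
  tree `KubertTateFourteen` + `X1FourteenMordellWeil`), entering here as the hypothesis `h14`
  (`P₂ + Q` has order `14`);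
* `p = 11`: Billing–Mahler, the tree's THEOREM `Mazur1977_no_eleven_torsion`;
* `p = 13`: Mazur–Tate 1973, the named fact `MazurTate1973_no_torsion_thirteen`;
* `p ≥ 17`: Mazur 1977, Ch. III §5, the named fact `Mazur1977_no_prime_torsion`, itself a theorem
  from `Mazur1977_stepThree_eisenstein` (`Mazur1977_no_prime_torsion_holds_of`) and needed only for
  `p ≥ 17` (`Mazur1977_no_prime_torsion_of_forall_seventeen_le`).

So Kubert's composite-order reduction `Mazur1977_reduction_to_primes` (the eleven curves
`X₁(14), X₁(15), …, X₁(49)`), which the `mazur_torsion` road needs, is replaced by the single case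
`X₁(14)`.

## Main statements

* `false_of_noTwoTorsionPrime_of_forall_smul_eq` — three `Γ_ℚ`-fixed geometric points, two of
  order `2` and one of order `p`, contradict `(⋆ₚ)`.
* `hasIrreducibleModPGaloisRep_of_isSemistable_of_rational_two_torsion_of_noTwoTorsionPrime` —
  Ribet's Prop. 1 (semistable case) for the prime `p ≥ 5`, from `(⋆ₚ)`.
* `noTwoTorsionPrime_five`, `noTwoTorsionPrime_seven_of`, `noTwoTorsionPrime_eleven`,
  `noTwoTorsionPrime_thirteen_of`, `noTwoTorsionPrime_of_seventeen_le_of`,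
  `noTwoTorsionPrime_of_leaves` — `(⋆ₚ)` prime by prime.
* `hasIrreducibleModPGaloisRep_of_isSemistable_of_rational_two_torsion_of_leaves` — Prop. 1 for all
  `p ≥ 5` from `h14`, `MazurTate1973_no_torsion_thirteen` and `Mazur1977_stepThree_eisenstein`.

## References

* [Ribet1997] K. A. Ribet, Acta Arith. 79 (1997) 7–16, Prop. 1 (p. 11–12).
* [Serre1987] J.-P. Serre, Duke Math. J. 54 (1987), §4.1 Prop. 6.
* [Mazur1977] B. Mazur, Publ. Math. IHÉS 47 (1977), Thm. 8 and Ch. III §5 (p. 156: First reduction).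
* [Kubert1976] D. S. Kubert, Proc. London Math. Soc. (3) 33 (1976) 193–237, Ch. IV.
* [MazurTate1973] B. Mazur, J. Tate, Invent. Math. 22 (1973) 41–49.

Design: no definitions, no named facts; `open scoped Classical` as in the sibling, so that the
point groups are those of `mazur_torsion`, `Kubert1976_no_two_ten`, `Mazur1977_no_prime_torsion`.
-/

noncomputable section

open scoped Classical

universe u

namespace Literature.NumberTheory.EllipticCurves

-- `_root_`: the import closure declares `Literature.NumberTheory.EllipticCurves.WeierstrassCurve.*`
open _root_.WeierstrassCurve TorsionAux

/-! ### Elements of order `2` in a cyclic group generated by an element of order `2m` -/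

/-- In an additive commutative group, if `R` has order `2 * m` and `P` is an element of order `2`
lying in `ℤ ∙ R`, then `P = m • R`. [folklore] -/
theorem eq_nsmul_of_mem_zmultiples_of_addOrderOf_eq_two {A : Type*} [AddCommGroup A] {R P : A}
    {m : ℕ} (hR : addOrderOf R = 2 * m) (hP : addOrderOf P = 2)
    (hmem : P ∈ AddSubgroup.zmultiples R) : P = m • R := by
  obtain ⟨k, rfl⟩ := AddSubgroup.mem_zmultiples_iff.mp hmem
  have h2 : (2 * k) • R = 0 := by
    rw [mul_zsmul, two_zsmul, ← two_nsmul, ← hP]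
    exact addOrderOf_nsmul_eq_zero _
  have hdvd : ((2 * m : ℕ) : ℤ) ∣ 2 * k := by
    rw [← hR]
    exact addOrderOf_dvd_iff_zsmul_eq_zero.mpr h2
  obtain ⟨j, hj⟩ := hdvd
  have hk : k = m * j := by push_cast at hj; linarith
  subst hk
  have hmR : ((2 * m : ℕ) : ℤ) • R = 0 := by
    rw [natCast_zsmul, ← hR]
    exact addOrderOf_nsmul_eq_zero R
  rcases Int.even_or_odd j with ⟨i, rfl⟩ | ⟨i, rfl⟩
  · exfalso
    have h0 : ((m : ℤ) * (i + i)) • R = 0 := by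
      rw [show (m : ℤ) * (i + i) = i * ((2 * m : ℕ) : ℤ) by push_cast; ring, mul_zsmul, hmR,
        zsmul_zero]
    have : addOrderOf (((m : ℤ) * (i + i)) • R) = 2 := hP
    rw [h0, addOrderOf_zero] at this
    exact absurd this (by norm_num)
  · rw [show (m : ℤ) * (2 * i + 1) = i * ((2 * m : ℕ) : ℤ) + (m : ℕ) by push_cast; ring, add_zsmul,
      mul_zsmul, hmR, zsmul_zero, zero_add, natCast_zsmul]

/-! ### `(⋆ₚ)` prime by prime -/

/-- **`(⋆₅)` from Kubert's theorem "no `ℤ/2 × ℤ/10` over `ℚ`"** (Kubert 1976, Ch. IV; the tree's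
theorem `Kubert1976_no_two_ten_holds`): rational `P₁ ≠ P₂` of order `2` and `Q` of order `5` give
the injective homomorphism `ℤ/2 × ℤ/10 → E(ℚ)`, `(a, b) ↦ aP₁ + b(P₂ + Q)` (`P₂ + Q` has order `10`,
and the only element of order `2` in `ℤ(P₂ + Q)` is `5(P₂ + Q) = P₂ ≠ P₁`).
[cite: Kubert1976, Ch. IV (X₁(2,10)); Mazur1977, Ch. III §5 p. 156] -/
theorem noTwoTorsionPrime_five (V : WeierstrassCurve ℚ) [V.IsElliptic]
    {P₁ P₂ Q : V.toAffine.Point} (hP₁ : addOrderOf P₁ = 2) (hP₂ : addOrderOf P₂ = 2)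
    (h12 : P₁ ≠ P₂) (hQ : addOrderOf Q = 5) : False := by
  set R := P₂ + Q with hRdef
  have hR : addOrderOf R = 10 := by
    rw [hRdef, (AddCommute.all P₂ Q).addOrderOf_add_eq_mul_addOrderOf_of_coprime
      (by rw [hP₂, hQ]; decide), hP₂, hQ]
  have h2P₁ : 2 • P₁ = 0 := hP₁ ▸ addOrderOf_nsmul_eq_zero P₁
  have h10R : 10 • R = 0 := hR ▸ addOrderOf_nsmul_eq_zero R
  have h5R : 5 • R = P₂ := by
    have h2P₂ : 2 • P₂ = 0 := hP₂ ▸ addOrderOf_nsmul_eq_zero P₂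
    have h5Q : 5 • Q = 0 := hQ ▸ addOrderOf_nsmul_eq_zero Q
    rw [hRdef, nsmul_add, h5Q, add_zero, show (5 : ℕ) = 2 + 2 + 1 from rfl, add_nsmul, add_nsmul,
      h2P₂, one_nsmul, zero_add, zero_add]
  set f : ZMod 2 × ZMod 10 →+ V.toAffine.Point :=
    (zmodHom P₁ 2 h2P₁).coprod (zmodHom R 10 h10R) with hf
  refine Kubert1976_no_two_ten_holds V ⟨f, ?_⟩
  refine (injective_iff_map_eq_zero f).mpr fun ab hab => ?_
  obtain ⟨a, b⟩ := ab
  rw [hf, AddMonoidHom.coprod_apply] at hab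
  rcases zmod_two_eq_zero_or_one a with rfl | rfl
  · rw [map_zero, zero_add] at hab
    have hb : b = 0 := (injective_iff_map_eq_zero _).mp (zmodHom_injective h10R hR) b hab
    rw [hb]
    rfl
  · exfalso
    rw [zmodHom_one] at hab
    have hmem : P₁ ∈ AddSubgroup.zmultiples R := by
      have h := eq_neg_of_add_eq_zero_left hab
      rw [h]
      refine neg_mem ?_
      rw [← range_zmodHom R 10 h10R]
      exact ⟨b, rfl⟩
    have := eq_nsmul_of_mem_zmultiples_of_addOrderOf_eq_two (m := 5) hR hP₁ hmem
    rw [h5R] at this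
    exact h12 this

/-- **`(⋆₇)` from "no rational point of order `14`"** (`X₁(14)(ℚ)` is cuspidal: Kubert 1976,
Ch. IV; in the tree `KubertTateFourteen` with `X1FourteenMordellWeil`): `P₂ + Q` has order
`2 · 7 = 14`. The input is the hypothesis `h14`. [cite: Kubert1976, Ch. IV (X₁(14)); Mazur1977, Ch. III §5 p. 156] -/
theorem noTwoTorsionPrime_seven_of
    (h14 : ∀ (V : WeierstrassCurve ℚ) [V.IsElliptic], ¬ ∃ P : V.toAffine.Point, addOrderOf P = 14)
    (V : WeierstrassCurve ℚ) [V.IsElliptic]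
    {P₁ P₂ Q : V.toAffine.Point} (_hP₁ : addOrderOf P₁ = 2) (hP₂ : addOrderOf P₂ = 2)
    (_h12 : P₁ ≠ P₂) (hQ : addOrderOf Q = 7) : False := by
  refine h14 V ⟨P₂ + Q, ?_⟩
  rw [(AddCommute.all P₂ Q).addOrderOf_add_eq_mul_addOrderOf_of_coprime
    (by rw [hP₂, hQ]; decide), hP₂, hQ]

/-- **`(⋆₁₁)` from Billing–Mahler** (no rational point of order `11`; the tree's theorem
`Mazur1977_no_eleven_torsion`). [cite: BillingMahler1940, main theorem; Mazur1977, Ch. III §5 p. 156] -/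
theorem noTwoTorsionPrime_eleven (V : WeierstrassCurve ℚ) [V.IsElliptic]
    {P₁ P₂ Q : V.toAffine.Point} (_hP₁ : addOrderOf P₁ = 2) (_hP₂ : addOrderOf P₂ = 2)
    (_h12 : P₁ ≠ P₂) (hQ : addOrderOf Q = 11) : False :=
  Mazur1977_no_eleven_torsion V ⟨Q, hQ⟩

/-- **`(⋆₁₃)` from Mazur–Tate 1973** (no rational point of order `13`; the named fact
`MazurTate1973_no_torsion_thirteen`, hypothesis `h13`). [cite: MazurTate1973, main theorem] -/
theorem noTwoTorsionPrime_thirteen_of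
    (h13 : ∀ V : WeierstrassCurve ℚ, MazurTate1973_no_torsion_thirteen V)
    (V : WeierstrassCurve ℚ) [V.IsElliptic]
    {P₁ P₂ Q : V.toAffine.Point} (_hP₁ : addOrderOf P₁ = 2) (_hP₂ : addOrderOf P₂ = 2)
    (_h12 : P₁ ≠ P₂) (hQ : addOrderOf Q = 13) : False :=
  h13 V ⟨Q, hQ⟩

/-- **`(⋆ₚ)` for `p ≥ 17` from Mazur 1977, Ch. III §5** (no rational point of prime order
`N ∉ {2,3,5,7,13}`: the named fact `Mazur1977_no_prime_torsion`, a theorem from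
`Mazur1977_stepThree_eisenstein` by `Mazur1977_no_prime_torsion_holds_of`; hypothesis `hE`).
[cite: Mazur1977, Ch. III §5, pp. 156–160] -/
theorem noTwoTorsionPrime_of_seventeen_le_of (hE : Mazur1977_stepThree_eisenstein)
    {p : ℕ} (hp : p.Prime) (h17 : 17 ≤ p) (V : WeierstrassCurve ℚ) [V.IsElliptic]
    {P₁ P₂ Q : V.toAffine.Point} (_hP₁ : addOrderOf P₁ = 2) (_hP₂ : addOrderOf P₂ = 2)
    (_h12 : P₁ ≠ P₂) (hQ : addOrderOf Q = p) : False := by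
  refine Mazur1977_no_prime_torsion_holds_of hE V p hp ?_ ⟨Q, hQ⟩
  simp only [Finset.mem_insert, Finset.mem_singleton, not_or]
  omega

/-- **`(⋆ₚ)` for every prime `p ≥ 5` from the three leaves**: no rational point of order `14`
(`h14`), Mazur–Tate 1973 (`h13`), and Mazur's Step 3 (`hE`, only for `p ≥ 17`); the primes
`5, 7, 11` being theorems of the tree (Kubert, `X₁(14)`, Billing–Mahler).
[cite: Ribet1997, Prop. 1 (p. 11–12)] [cite: Mazur1977, Thm 8 and Ch. III §5 p. 156] -/
theorem noTwoTorsionPrime_of_leaves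
    (h14 : ∀ (V : WeierstrassCurve ℚ) [V.IsElliptic], ¬ ∃ P : V.toAffine.Point, addOrderOf P = 14)
    (h13 : ∀ V : WeierstrassCurve ℚ, MazurTate1973_no_torsion_thirteen V)
    (hE : Mazur1977_stepThree_eisenstein) {p : ℕ} (hp : p.Prime) (h5 : 5 ≤ p)
    (V : WeierstrassCurve ℚ) [V.IsElliptic]
    {P₁ P₂ Q : V.toAffine.Point} (hP₁ : addOrderOf P₁ = 2) (hP₂ : addOrderOf P₂ = 2)
    (h12 : P₁ ≠ P₂) (hQ : addOrderOf Q = p) : False := by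
  by_cases h17 : 17 ≤ p
  · exact noTwoTorsionPrime_of_seventeen_le_of hE hp h17 V hP₁ hP₂ h12 hQ
  · rcases prime_lt_seventeen hp (not_le.mp h17) with rfl | rfl | rfl | rfl | rfl | rfl
    · omega
    · omega
    · exact noTwoTorsionPrime_five V hP₁ hP₂ h12 hQ
    · exact noTwoTorsionPrime_seven_of h14 V hP₁ hP₂ h12 hQ
    · exact noTwoTorsionPrime_eleven V hP₁ hP₂ h12 hQ
    · exact noTwoTorsionPrime_thirteen_of h13 V hP₁ hP₂ h12 hQ

/-! ### Three fixed geometric points contradict `(⋆ₚ)` -/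

/-- **Three `Γ_ℚ`-fixed geometric points — two of order `2`, one of order `p` — contradict
`(⋆ₚ)` for `E.baseChange ℚ`** (Galois descent `exists_addOrderOf_eq_of_forall_smul_eq`, keeping
orders). [cite: Ribet1997, Prop. 1 (p. 11–12)] -/
theorem false_of_noTwoTorsionPrime_of_forall_smul_eq (V : WeierstrassCurve ℚ) [V.IsElliptic]
    {p : ℕ}
    (hNo : ∀ (P₁ P₂ Q : (V.baseChange ℚ).toAffine.Point), addOrderOf P₁ = 2 → addOrderOf P₂ = 2 →
      P₁ ≠ P₂ → addOrderOf Q = p → False)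
    {P₁ P₂ Q : V.geomPoints} (hP₁ : addOrderOf P₁ = 2) (hP₂ : addOrderOf P₂ = 2) (h12 : P₁ ≠ P₂)
    (hQ : addOrderOf Q = p) (hσ₁ : ∀ σ : Field.absoluteGaloisGroup ℚ, σ • P₁ = P₁)
    (hσ₂ : ∀ σ : Field.absoluteGaloisGroup ℚ, σ • P₂ = P₂)
    (hσQ : ∀ σ : Field.absoluteGaloisGroup ℚ, σ • Q = Q) : False := by
  obtain ⟨R₁, hR₁, hoR₁⟩ := exists_addOrderOf_eq_of_forall_smul_eq V P₁ hσ₁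
  obtain ⟨R₂, hR₂, hoR₂⟩ := exists_addOrderOf_eq_of_forall_smul_eq V P₂ hσ₂
  obtain ⟨S, hS, hoS⟩ := exists_addOrderOf_eq_of_forall_smul_eq V Q hσQ
  refine hNo R₁ R₂ S (hoR₁.trans hP₁) (hoR₂.trans hP₂) (fun h ↦ h12 ?_) (hoS.trans hQ)
  rw [← hR₁, ← hR₂, h]

/-! ### The theorem, prime by prime -/

/-- **Ribet 1997, Prop. 1 (semistable case) / Serre 1987, §4.1 Prop. 6, for ONE prime `p ≥ 5`,
from `(⋆ₚ)`.**  Let `E/ℚ` be a semistable elliptic curve all of whose `2`-torsion points are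
rational (`Γ_ℚ`-fixed), let `p ≥ 5` be prime, and suppose `(⋆ₚ)`: no elliptic curve over `ℚ` has
rational points `P₁ ≠ P₂` of order `2` and `Q` of order `p` (hypothesis `hNo`).  Then `E[p]` is an
irreducible `Γ_ℚ`-module.  The proof is that of
`hasIrreducibleModPGaloisRep_of_isSemistable_of_rational_two_torsion_of_mazur_torsion` verbatim
(Serre's Prop. 21 `Edixhoven1997_prop_2_1_holds`; a pointwise-fixed stable line gives
`E(ℚ) ⊇ ℤ/2 ⊕ ℤ/2 ⊕ ℤ/p`, a line with trivial quotient action gives the same in `E' = E/H`,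
`exists_isogeny_ker_eq_and_comp_eq_nsmul_holds`), with `(⋆ₚ)` in place of Mazur's list.
[cite: Ribet1997, Prop. 1 (p. 11–12)] [cite: Serre1987, §4.1 Prop. 6] -/
theorem hasIrreducibleModPGaloisRep_of_isSemistable_of_rational_two_torsion_of_noTwoTorsionPrime
    {p : ℕ}
    (hNo : ∀ (V : WeierstrassCurve ℚ) [V.IsElliptic] (P₁ P₂ Q : V.toAffine.Point),
      addOrderOf P₁ = 2 → addOrderOf P₂ = 2 → P₁ ≠ P₂ → addOrderOf Q = p → False)
    (W : WeierstrassCurve ℚ) [W.IsElliptic] (hW : W.IsSemistable ℤ)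
    (h2 : ∀ (σ : Field.absoluteGaloisGroup ℚ) (P : W.geomPoints), 2 • P = 0 → σ • P = P)
    (hp : p.Prime) (h5 : 5 ≤ p) : W.HasIrreducibleModPGaloisRep p := by
  haveI : Fact p.Prime := ⟨hp⟩
  haveI : NeZero (p : ℚ) := ⟨Nat.cast_ne_zero.mpr hp.ne_zero⟩
  have hp2 : p ≠ 2 := by omega
  rcases Edixhoven1997_prop_2_1_holds W hW p hp with hsurj | ⟨H, hstab, hbot, htop, hH⟩
  · exact hasIrreducibleModPGaloisRep_of_hasSurjectiveModNGaloisRep W p hsurj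
  exfalso
  /- Two independent rational `2`-torsion points `P, Q`. -/
  have h2K : ((2 : ℕ) : ℚ) ≠ 0 := by norm_num
  haveI : Finite (geomTorsion W ((2 : ℕ) : ℤ)) := finite_geomTorsion_natCast W two_ne_zero
  obtain ⟨P, Q, hP2, hQ2, hP0, hQ0, hPQ⟩ :
      ∃ P Q : W.geomPoints, 2 • P = 0 ∧ 2 • Q = 0 ∧ P ≠ 0 ∧ Q ≠ 0 ∧ P ≠ Q := by
    haveI : Fintype (geomTorsion W ((2 : ℕ) : ℤ)) := Fintype.ofFinite _
    have h3 : 2 < Fintype.card (geomTorsion W ((2 : ℕ) : ℤ)) := by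
      rw [← Nat.card_eq_fintype_card, natCard_geomTorsion_eq_sq W h2K]; norm_num
    obtain ⟨a, b, c, hab, hac, hbc⟩ := Fintype.two_lt_card_iff.1 h3
    have mem2 : ∀ x : geomTorsion W ((2 : ℕ) : ℤ), 2 • (x : W.geomPoints) = 0 := fun x ↦
      AddSubgroup.torsionBy.nsmul_iff.1 x.2
    have hne : ∀ {x y : geomTorsion W ((2 : ℕ) : ℤ)}, x ≠ y → (x : W.geomPoints) ≠ y :=
      fun hxy h ↦ hxy (Subtype.ext h)
    by_cases ha : (a : W.geomPoints) = 0
    · refine ⟨b, c, mem2 b, mem2 c, fun hb ↦ hne hab (ha.trans hb.symm), fun hc ↦ hne hac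
        (ha.trans hc.symm), hne hbc⟩
    · by_cases hb : (b : W.geomPoints) = 0
      · exact ⟨a, c, mem2 a, mem2 c, ha, fun hc ↦ hne hbc (hb.trans hc.symm), hne hac⟩
      · exact ⟨a, b, mem2 a, mem2 b, ha, hb, hne hab⟩
  have hordP : addOrderOf P = 2 := addOrderOf_eq_prime hP2 hP0
  have hordQ : addOrderOf Q = 2 := addOrderOf_eq_prime hQ2 hQ0
  /- A generator `s₀` of the stable line `H`, and a point `T₀ ∈ E[p] ∖ H`. -/
  obtain ⟨s₀, hs₀H, hs₀0, hHeq⟩ := exists_eq_zmultiples_of_ne_bot_of_ne_top W p H hbot htop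
  have hs₀0' : (s₀ : W.geomPoints) ≠ 0 := fun h ↦ hs₀0 (Subtype.ext h)
  have hmemp : ∀ x : geomTorsion W (p : ℤ), p • (x : W.geomPoints) = 0 := fun x ↦ by
    have h := (mem_torsionPoints_iff _ _ (x : W.geomPoints)).mp x.2
    rwa [natCast_zsmul] at h
  have hords₀ : addOrderOf (s₀ : W.geomPoints) = p := addOrderOf_eq_prime (hmemp s₀) hs₀0'
  rcases hH with hfix | hquot
  · /- Case 1: `Γ_ℚ` fixes `H` pointwise: `E(ℚ) ⊇ ℤ/2 ⊕ ℤ/2 ⊕ ℤ/p`. -/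
    refine false_of_noTwoTorsionPrime_of_forall_smul_eq W (hNo _) hordP hordQ hPQ hords₀
      (fun σ ↦ h2 σ P hP2) (fun σ ↦ h2 σ Q hQ2) fun σ ↦ ?_
    have := hfix σ s₀ hs₀H
    simpa only [AddSubgroup.torsionBy.coe_smul] using congrArg Subtype.val this
  · /- Case 2: `Γ_ℚ` acts trivially on `E[p]/H`: pass to `E' = E/H`. -/
    obtain ⟨T₀, hT₀⟩ : ∃ T₀ : geomTorsion W (p : ℤ), T₀ ∉ H := by
      by_contra h
      push Not at h
      exact htop (eq_top_iff.mpr fun x _ ↦ h x)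
    set S : AddSubgroup W.geomPoints := H.map (geomTorsion W (p : ℤ)).subtype with hS
    have hSmem : ∀ {x : W.geomPoints}, x ∈ S ↔ ∃ y : geomTorsion W (p : ℤ), y ∈ H ∧ (y : _) = x :=
      fun {x} ↦ by simp only [hS, AddSubgroup.mem_map, AddSubgroup.coe_subtype]
    have hScard : Nat.card S = p := by
      have hHcard : Nat.card H = p := by
        rw [hHeq, Nat.card_zmultiples, ← AddSubgroup.addOrderOf_coe]
        exact hords₀
      rw [← hHcard]
      exact Nat.card_congr (H.equivMapOfInjective _ (geomTorsion W (p : ℤ)).subtype_injective).symm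
    have hSfin : (S : Set W.geomPoints).Finite := by
      have h : Nat.card S ≠ 0 := by rw [hScard]; exact hp.ne_zero
      exact Nat.finite_of_card_ne_zero h
    have hSstab : ∀ (σ : Field.absoluteGaloisGroup ℚ) (x : W.geomPoints), x ∈ S → σ • x ∈ S := by
      intro σ x hx
      obtain ⟨y, hy, rfl⟩ := hSmem.mp hx
      exact hSmem.mpr ⟨σ • y, hstab σ y hy, rfl⟩
    obtain ⟨W', hW', g, -, hker, -, -⟩ :=
      exists_isogeny_ker_eq_and_comp_eq_nsmul_holds (W := W) S hSfin hSstab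
    haveI := hW'
    -- membership in `S = ker g` forces `p`-torsion
    have hSp : ∀ {x : W.geomPoints}, x ∈ S → p • x = 0 := fun hx ↦ by
      obtain ⟨y, -, rfl⟩ := hSmem.mp hx
      exact hmemp y
    have hker' : ∀ {x : W.geomPoints}, g x = 0 ↔ x ∈ S := fun {x} ↦ by
      rw [← hker]; rfl
    -- the images of `P`, `Q`, `T₀`
    have hgP0 : g P ≠ 0 := fun h ↦ hP0 (eq_zero_of_two_nsmul_of_prime_nsmul hp hp2 hP2
      (hSp (hker'.mp h)))
    have hgQ0 : g Q ≠ 0 := fun h ↦ hQ0 (eq_zero_of_two_nsmul_of_prime_nsmul hp hp2 hQ2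
      (hSp (hker'.mp h)))
    have hgPQ : g P ≠ g Q := fun h ↦ by
      have h0 : g (P - Q) = 0 := by rw [map_sub, h, sub_self]
      have h2PQ : 2 • (P - Q) = 0 := by rw [nsmul_sub, hP2, hQ2, sub_self]
      exact hPQ (sub_eq_zero.mp (eq_zero_of_two_nsmul_of_prime_nsmul hp hp2 h2PQ
        (hSp (hker'.mp h0))))
    have hgT0 : g (T₀ : W.geomPoints) ≠ 0 := fun h ↦ by
      obtain ⟨y, hy, hyT⟩ := hSmem.mp (hker'.mp h)
      exact hT₀ (Subtype.ext hyT ▸ hy)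
    have hordgP : addOrderOf (g P) = 2 :=
      addOrderOf_eq_prime (by rw [← map_nsmul, hP2, map_zero]) hgP0
    have hordgQ : addOrderOf (g Q) = 2 :=
      addOrderOf_eq_prime (by rw [← map_nsmul, hQ2, map_zero]) hgQ0
    have hordgT : addOrderOf (g (T₀ : W.geomPoints)) = p :=
      addOrderOf_eq_prime (by rw [← map_nsmul, hmemp T₀, map_zero]) hgT0
    refine false_of_noTwoTorsionPrime_of_forall_smul_eq W' (hNo _) hordgP hordgQ hgPQ hordgT
      (fun σ ↦ by rw [← g.map_smul, h2 σ P hP2]) (fun σ ↦ by rw [← g.map_smul, h2 σ Q hQ2])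
      fun σ ↦ ?_
    -- `σ • T₀ - T₀ ∈ H`, so `g` identifies `σ • g T₀ = g (σ • T₀)` with `g T₀`
    have hmem : σ • (T₀ : W.geomPoints) - T₀ ∈ S := by
      refine hSmem.mpr ⟨σ • T₀ - T₀, hquot σ T₀, ?_⟩
      simp only [AddSubgroup.coe_sub, AddSubgroup.torsionBy.coe_smul]
    have h0 : g (σ • (T₀ : W.geomPoints) - T₀) = 0 := hker'.mpr hmem
    rw [map_sub, sub_eq_zero] at h0
    rw [← g.map_smul, h0]

/-- **Ribet 1997, Prop. 1 (semistable case), all primes `p ≥ 5`, from the three leaves** — no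
rational point of order `14` (`h14`: `X₁(14)`, Kubert 1976 Ch. IV; a theorem of the tree once
`KubertTateFourteen` and `X1FourteenMordellWeil` are combined), Mazur–Tate 1973 (`h13`) and
Mazur's Step 3 (`hE`) — instead of the full classification `∀ V, mazur_torsion V`.
[cite: Ribet1997, Prop. 1 (p. 11–12)] [cite: Serre1987, §4.1 Prop. 6] [cite: Mazur1977, Thm 8] -/
theorem hasIrreducibleModPGaloisRep_of_isSemistable_of_rational_two_torsion_of_leaves
    (h14 : ∀ (V : WeierstrassCurve ℚ) [V.IsElliptic], ¬ ∃ P : V.toAffine.Point, addOrderOf P = 14)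
    (h13 : ∀ V : WeierstrassCurve ℚ, MazurTate1973_no_torsion_thirteen V)
    (hE : Mazur1977_stepThree_eisenstein)
    (W : WeierstrassCurve ℚ) [W.IsElliptic] (hW : W.IsSemistable ℤ)
    (h2 : ∀ (σ : Field.absoluteGaloisGroup ℚ) (P : W.geomPoints), 2 • P = 0 → σ • P = P)
    {p : ℕ} (hp : p.Prime) (h5 : 5 ≤ p) : W.HasIrreducibleModPGaloisRep p :=
  hasIrreducibleModPGaloisRep_of_isSemistable_of_rational_two_torsion_of_noTwoTorsionPrime
    (fun V _ _ _ _ hP₁ hP₂ h12 hQ ↦ noTwoTorsionPrime_of_leaves h14 h13 hE hp h5 V hP₁ hP₂ h12 hQ)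
    W hW h2 hp h5

end Literature.NumberTheory.EllipticCurves
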